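import Literature.Computability.AlgebraicComplexity.SchoenhageTau
import Literature.Computability.AlgebraicComplexity.BorderRankCW
import Literature.Barriers.MatrixMultiplication.IrreversibilityBarrier
import HarnessLib

/-!
# The Coppersmith–Winograd tensor `CW_q` and its border rank `bR(CW_q) ≤ q + 2` — proved

Topic `Literature/Computability/AlgebraicComplexity`. The base tensor of every bound on `ω` since
1987 (Coppersmith–Winograd 1990, §7; Stothers, Vassilevska Williams, Le Gall, Alman–Vassilevska
Williams, Duan–Wu–Zhou, Vassilevska Williams–Xu–Xu–Zhou 2024, Alman–Duan–Vassilevska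
Williams–Xu–Xu–Zhou 2025, §3.6):

  `CW_q = ∑_{i=1}^{q} (x₀ yᵢ zᵢ + xᵢ y₀ zᵢ + xᵢ yᵢ z₀) + x₀ y₀ z_{q+1} + x₀ y_{q+1} z₀ + x_{q+1} y₀ z₀`

on the variables `x₀, …, x_{q+1}` (and likewise `y`, `z`). The coordinate tensor is ALREADY in the
tree as `Literature.Barriers.MatrixMultiplication.bigCwTensor K q : Fin (q+2) → Fin (q+2) → Fin (q+2) → K`
(`IrreversibilityBarrier.lean`, vendored there for CVZ 2021, Thm. 22, together with the lower bound
`q + 2 ≤ R̃(CW_q)`, `le_asymptoticRank_bigCwTensor`, in `UniversalMethodBarrierCwCore.lean`); it is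
REUSED here, not redefined (hence the import of a barrier file into this topic file). The "little"
tensor `cwTensor K q` of `BorderRankCW.lean` (CGLV's `T_{cw,q}`, on `Fin (q+1)`) is its restriction
to the indices `≠ q+1` (`bigCwTensor_castSucc`).

## Main result (proved)

Coppersmith–Winograd's `q + 2`-products approximate algorithm (CW 1990, §7, eq. (10); Bürgisser–
Clausen–Shokrollahi 1997, §15.8, the identity preceding Cor. (15.45)), multiplied through by `ε³`:

  `∑_{i=1}^{q} ε (x₀ + ε xᵢ)(y₀ + ε yᵢ)(z₀ + ε zᵢ) − (x₀ + ε² ∑ᵢ xᵢ)(y₀ + ε² ∑ᵢ yᵢ)(z₀ + ε² ∑ᵢ zᵢ)`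
  `+ (1 − q ε)(x₀ + ε³ x_{q+1})(y₀ + ε³ y_{q+1})(z₀ + ε³ z_{q+1}) = ε³ CW_q + O(ε⁴)`,

is an order-`3` approximate decomposition with `q + 2` triads over `K[ε]` in the sense of
Bläser 2013, Def. 6.1 (`IsApproxDecomposition`, `SchoenhageTau.lean`), for every commutative ring
`K` (the coefficients are `±1` and `q`): `isApproxDecomposition_bigCwTensor`. Hence
`R_3(CW_q) ≤ q + 2` (`approxRank_three_bigCwTensor_le`) and **`bR(CW_q) ≤ q + 2`**
(`algBorderRank_bigCwTensor_le`; BCS 1997, §15.8: "shows that `bR(t) ≤ q + 2`"; ADVXXZ 2025,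
§3.6: "Coppersmith and Winograd showed that `R̃(CW_q) ≤ q + 2`").

## Named facts (statements only)

* `BCS1997_algBorderRank_bigCwTensor` — "(Since `t` is concise we even have `bR(t) = q + 2`.)"
  (BCS 1997, §15.8, for the standing `q ≥ 2`); the `≤` half is the theorem above.
* `advxxz2025_asymptoticRank_bigCwTensor_le` — `R̃(CW_q) ≤ q + 2` for the asymptotic rank
  `asymptoticRank` of `AsymptoticSpectrum.lean` (ADVXXZ 2025, §3.6). DISCHARGED in the sibling
  `BigCoppersmithWinogradProofs.lean` (`advxxz2025_asymptoticRank_bigCwTensor_le_holds`, indeed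
  `R̃(CW_q) = q + 2` over fields, `asymptoticRank_bigCwTensor`) from the theorem above and
  `R̃ ≤ bR` (`asymptoticRank_le_algBorderRank`, `AsymptoticRankBorderRank.lean`, via Bläser 2013,
  Thm. 6.3(3)/Lemma 6.4 as proved in `SchoenhageTauBini.lean`, `SchoenhageTauProofs.lean`,
  `BorderRankKronecker.lean`).

## Design notes

* Index conventions: `0`, the middle indices `cwMid i = i + 1` (`i : Fin q`), and `Fin.last (q+1)`;
  `cwCases` is the corresponding case analysis and `sum_univ_fin_add_two` the corresponding
  splitting of `∑_{ρ : Fin (q+2)}`.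
* The vectors `bigCwU ρ`, `bigCwV ρ = bigCwW ρ ∈ K[ε]^{q+2}` of the `q + 2` triads are indexed by
  `ρ : Fin (q+2)`: `ρ = 0` is the product `−(x₀ + ε² ∑ xᵢ) ⊗ (y₀ + ε² ∑ yᵢ) ⊗ (z₀ + ε² ∑ zᵢ)`,
  `ρ = q + 1` the product `((1 − qε) x₀ + ε³ x_{q+1}) ⊗ (y₀ + ε³ y_{q+1}) ⊗ (z₀ + ε³ z_{q+1})` (the
  printed factor `(1 − qε)(x₀ + ε³ x_{q+1})` minus its irrelevant `−q ε⁴ x_{q+1}` term), and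
  `ρ = i ∈ {1, …, q}` the product `ε (x₀ + ε xᵢ) ⊗ (y₀ + ε yᵢ) ⊗ (z₀ + ε zᵢ)` (scalar factors put
  into the first vector).
* Nothing here uses a topology: `algBorderRank` is Bläser's algebraic border rank over `K[ε]`,
  valid over every field (indeed every commutative ring).

## References

* D. Coppersmith, S. Winograd, *Matrix multiplication via arithmetic progressions*, J. Symbolic
  Comput. 9 (1990) 251–280, §7 "New construction: complicated version", eq. (10), p. 262
  (held: `paper:doi-10-1016-s0747-7171-08-80013-2`, p. 12). [CoppersmithWinograd1990]
* P. Bürgisser, M. Clausen, M. A. Shokrollahi, *Algebraic Complexity Theory*, Springer 1997, §15.8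
  (second application of Thm. (15.41): the tensor `t^{(q)} ∈ (k^{q+2})^{⊗3}`, the identity,
  Rem. (15.44), Cor. (15.45) `ω < 2.39`). [BurgisserClausenShokrollahi1997]
* J. Alman, R. Duan, V. Vassilevska Williams, Y. Xu, Z. Xu, R. Zhou, *More asymmetry yields
  faster matrix multiplication*, SODA 2025, arXiv:2404.16349, §3.6. [AlmanDuanVassilevskaWilliamsXuXuZhou2025]
* M. Bläser, *Fast Matrix Multiplication*, Theory of Computing Graduate Surveys 5 (2013), Def. 6.1,
  Lemma 6.4. [Blaser2013]
-/

noncomputable section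

open scoped BigOperators Polynomial
open Polynomial (monomial)

namespace Literature.Computability.AlgebraicComplexity

universe u

/-! ## The indices `0`, `1, …, q`, `q + 1` -/

section Index

variable {q : ℕ}

/-- The middle indices `1, …, q` of `{0, …, q + 1} = Fin (q + 2)`: `cwMid i = i + 1`. [folklore] -/
def cwMid (i : Fin q) : Fin (q + 2) :=
  i.castSucc.succ

/-- `cwMid i = i + 1` as a natural number. [folklore] -/
@[simp] theorem coe_cwMid (i : Fin q) : (cwMid i : ℕ) = i + 1 := by
  simp [cwMid]

/-- A middle index is not `0`. [folklore] -/
theorem cwMid_ne_zero (i : Fin q) : cwMid i ≠ 0 := by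
  simp [Fin.ext_iff]

/-- `0` is not a middle index. [folklore] -/
theorem zero_ne_cwMid (i : Fin q) : (0 : Fin (q + 2)) ≠ cwMid i :=
  (cwMid_ne_zero i).symm

/-- A middle index is not `q + 1`. [folklore] -/
theorem cwMid_ne_last (i : Fin q) : cwMid i ≠ Fin.last (q + 1) := by
  rw [Ne, Fin.ext_iff, coe_cwMid, Fin.val_last]
  omega

/-- `q + 1` is not a middle index. [folklore] -/
theorem last_ne_cwMid (i : Fin q) : Fin.last (q + 1) ≠ cwMid i :=
  (cwMid_ne_last i).symm

/-- `cwMid` is injective. [folklore] -/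
theorem cwMid_inj {i j : Fin q} : cwMid i = cwMid j ↔ i = j := by
  simp [Fin.ext_iff]

/-- Case analysis on `Fin (q + 2)`: an index is `0`, a middle index, or `q + 1`. [folklore] -/
@[elab_as_elim]
theorem cwCases {motive : Fin (q + 2) → Prop} (zero : motive 0) (mid : ∀ i : Fin q, motive (cwMid i))
    (last : motive (Fin.last (q + 1))) (a : Fin (q + 2)) : motive a := by
  refine Fin.cases zero (fun j => ?_) a
  refine Fin.lastCases ?_ (fun i => ?_) j
  · rw [Fin.succ_last]; exact last
  · exact mid i

/-- `∑_{ρ < q+2} f ρ = f 0 + f (q+1) + ∑_{i < q} f (i + 1)`. [folklore] -/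
theorem sum_univ_fin_add_two {M : Type*} [AddCommMonoid M] (f : Fin (q + 2) → M) :
    ∑ ρ, f ρ = f 0 + f (Fin.last (q + 1)) + ∑ i : Fin q, f (cwMid i) := by
  rw [Fin.sum_univ_succ, Fin.sum_univ_castSucc, Fin.succ_last]
  simp only [cwMid]
  abel

end Index

/-! ## The tensor `CW_q` -/

section Tensor

open Literature.Barriers.MatrixMultiplication (bigCwTensor)

variable (K : Type u) [CommSemiring K]

/-- On the indices `≠ q + 1` the tensor `CW_q` is the little Coppersmith–Winograd tensor `T_{cw,q}`
(`cwTensor`), i.e. `CW_q = T_{cw,q} + x₀y₀z_{q+1} + x₀y_{q+1}z₀ + x_{q+1}y₀z₀`.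
[cite: BurgisserClausenShokrollahi1997, §15.8] -/
theorem bigCwTensor_castSucc (q : ℕ) (a b c : Fin (q + 1)) :
    bigCwTensor K q a.castSucc b.castSucc c.castSucc = cwTensor K q a b c := by
  have hl : ∀ x : Fin (q + 1), x.castSucc ≠ Fin.last (q + 1) := fun x => (Fin.castSucc_lt_last x).ne
  simp only [bigCwTensor, cwTensor, Fin.castSucc_inj, Fin.castSucc_eq_zero_iff, hl, ne_eq,
    not_false_eq_true, and_true, and_false, or_false, false_and]

/-- The corner entry `(0, q+1, 0)` of `CW_q` is `1` (the entry `(0, 0, q+1)` is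
`Literature.Barriers.MatrixMultiplication.bigCwTensor_corner`). [cite: CoppersmithWinograd1990, §7 eq. (10)] -/
theorem bigCwTensor_zero_last_zero (q : ℕ) : bigCwTensor K q 0 (Fin.last (q + 1)) 0 = 1 := by
  simp [bigCwTensor]

/-- The corner entry `(q+1, 0, 0)` of `CW_q` is `1`. [cite: CoppersmithWinograd1990, §7 eq. (10)] -/
theorem bigCwTensor_last_zero_zero (q : ℕ) : bigCwTensor K q (Fin.last (q + 1)) 0 0 = 1 := by
  simp [bigCwTensor]

/-- The entries `(0, i, j)` of `CW_q` for middle indices: `[i = j]`. [cite: CoppersmithWinograd1990, §7 eq. (10)] -/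
theorem bigCwTensor_zero_mid_mid (q : ℕ) (i j : Fin q) :
    bigCwTensor K q 0 (cwMid i) (cwMid j) = if i = j then 1 else 0 := by
  simp [bigCwTensor, cwMid_ne_zero, cwMid_ne_last, cwMid_inj]

/-- The entries `(i, 0, j)` of `CW_q` for middle indices: `[i = j]`. [cite: CoppersmithWinograd1990, §7 eq. (10)] -/
theorem bigCwTensor_mid_zero_mid (q : ℕ) (i j : Fin q) :
    bigCwTensor K q (cwMid i) 0 (cwMid j) = if i = j then 1 else 0 := by
  simp [bigCwTensor, cwMid_ne_zero, cwMid_ne_last, cwMid_inj]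

/-- The entries `(i, j, 0)` of `CW_q` for middle indices: `[i = j]`. [cite: CoppersmithWinograd1990, §7 eq. (10)] -/
theorem bigCwTensor_mid_mid_zero (q : ℕ) (i j : Fin q) :
    bigCwTensor K q (cwMid i) (cwMid j) 0 = if i = j then 1 else 0 := by
  simp [bigCwTensor, cwMid_ne_zero, cwMid_ne_last, cwMid_inj]

/-- `CW_q` vanishes on middle triples `(i, j, k)`. [cite: CoppersmithWinograd1990, §7 eq. (10)] -/
theorem bigCwTensor_mid_mid_mid (q : ℕ) (i j k : Fin q) :
    bigCwTensor K q (cwMid i) (cwMid j) (cwMid k) = 0 := by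
  simp [bigCwTensor, cwMid_ne_zero, cwMid_ne_last]

end Tensor

/-! ## Coppersmith–Winograd's `q + 2` approximate triads -/

section Decomposition

open Literature.Barriers.MatrixMultiplication (bigCwTensor)

/-- Coefficients of an `if`-expression of polynomials. [folklore] -/
theorem coeff_ite {R : Type u} [Semiring R] (P : Prop) [Decidable P] (p r : R[X]) (n : ℕ) :
    (if P then p else r).coeff n = if P then p.coeff n else r.coeff n := by
  split_ifs <;> rfl

variable (K : Type u) [CommRing K]

/-- The first vectors `u_ρ ∈ K[ε]^{q+2}` of the `q + 2` triads: `u_0 = −(x₀ + ε² ∑ᵢ xᵢ)`,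
`u_{q+1} = (1 − qε) x₀ + ε³ x_{q+1}` (the printed `(1 − qε)(x₀ + ε³ x_{q+1})` without its `ε⁴` term,
which does not affect the order-`3` condition), `u_i = ε (x₀ + ε xᵢ)` for `1 ≤ i ≤ q` (the identity
of BCS 1997, §15.8, multiplied by `ε³`). [cite: BurgisserClausenShokrollahi1997, §15.8] -/
def bigCwU (q : ℕ) (ρ a : Fin (q + 2)) : K[X] :=
  if ρ = 0 then (if a = 0 then -1 else if a = Fin.last (q + 1) then 0 else -monomial 2 1)
  else if ρ = Fin.last (q + 1) then
    (if a = 0 then 1 - monomial 1 (q : K) else if a = Fin.last (q + 1) then monomial 3 1 else 0)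
  else (if a = 0 then monomial 1 1 else if a = ρ then monomial 2 1 else 0)

/-- The second (= third) vectors `v_ρ = w_ρ ∈ K[ε]^{q+2}` of the `q + 2` triads:
`v_0 = y₀ + ε² ∑ᵢ yᵢ`, `v_{q+1} = y₀ + ε³ y_{q+1}`, `v_i = y₀ + ε yᵢ` for `1 ≤ i ≤ q`.
[cite: BurgisserClausenShokrollahi1997, §15.8] -/
def bigCwV (q : ℕ) (ρ b : Fin (q + 2)) : K[X] :=
  if ρ = 0 then (if b = 0 then 1 else if b = Fin.last (q + 1) then 0 else monomial 2 1)
  else if ρ = Fin.last (q + 1) then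
    (if b = 0 then 1 else if b = Fin.last (q + 1) then monomial 3 1 else 0)
  else (if b = 0 then 1 else if b = ρ then monomial 1 1 else 0)

/-- **Coppersmith–Winograd's identity**: the `q + 2` triads `u_ρ ⊗ v_ρ ⊗ v_ρ` form an order-`3`
approximate decomposition of `CW_q` over `K[ε]`,
`∑_ρ u_ρ ⊗ v_ρ ⊗ v_ρ = ε³ CW_q + O(ε⁴)` (CW 1990, §7, eq. (10); BCS 1997, §15.8).
[cite: BurgisserClausenShokrollahi1997, §15.8 (identity before Cor. 15.45)] -/
theorem isApproxDecomposition_bigCwTensor (q : ℕ) :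
    IsApproxDecomposition 3 (bigCwTensor K q) (bigCwU K q) (bigCwV K q) (bigCwV K q) := by
  intro a b c j hj
  rw [sum_univ_fin_add_two]
  induction a using cwCases <;> induction b using cwCases <;> induction c using cwCases <;>
    interval_cases j <;>
    simp [bigCwTensor, bigCwU, bigCwV, cwMid_ne_zero, zero_ne_cwMid, cwMid_ne_last, last_ne_cwMid,
      cwMid_inj, Polynomial.coeff_monomial, Polynomial.coeff_one, Polynomial.monomial_mul_monomial,
      coeff_ite, Finset.sum_ite_eq, ite_mul, mul_ite, sub_mul]

/-- **`R_3(CW_q) ≤ q + 2`** (order-`3` approximate rank). [cite: BurgisserClausenShokrollahi1997, §15.8] -/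
theorem approxRank_three_bigCwTensor_le (q : ℕ) : approxRank 3 (bigCwTensor K q) ≤ q + 2 :=
  approxRank_le_of_isApproxDecomposition (isApproxDecomposition_bigCwTensor K q)

/-- **Coppersmith–Winograd: `bR(CW_q) ≤ q + 2`** (border rank over `K[ε]`, every commutative ring
`K`; CW 1990, §7; BCS 1997, §15.8 "shows that `bR(t) ≤ q + 2`"; ADVXXZ 2025, §3.6).
[cite: BurgisserClausenShokrollahi1997, §15.8] -/
theorem algBorderRank_bigCwTensor_le (q : ℕ) : algBorderRank (bigCwTensor K q) ≤ q + 2 :=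
  (algBorderRank_le_approxRank 3 _).trans (approxRank_three_bigCwTensor_le K q)

end Decomposition

/-! ## Named facts -/

section Facts

open Literature.Barriers.MatrixMultiplication (bigCwTensor)

/-- **BCS 1997, §15.8**: for `q ≥ 2` the tensor `CW_q ∈ (k^{q+2})^{⊗3}` is concise, so its border
rank is exactly `q + 2` ("Since `t` is concise we even have `bR(t) = q + 2`"), over any field.
Named fact (the `≤` half is `algBorderRank_bigCwTensor_le`; the `≥` half needs the flattening lower
bound for border rank, not in the tree). [cite: BurgisserClausenShokrollahi1997, §15.8] -/
def BCS1997_algBorderRank_bigCwTensor : Prop :=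
  ∀ (K : Type) [Field K] (q : ℕ), 2 ≤ q → algBorderRank (bigCwTensor K q) = q + 2

/-- **ADVXXZ 2025, §3.6** (from Coppersmith–Winograd 1990): the asymptotic rank of `CW_q` is at most
`q + 2`, `R̃(CW_q) ≤ q + 2`, over any field ("all tensors in the paper can be considered to be over
any `F`", §3.1). Named fact; it follows from `algBorderRank_bigCwTensor_le` and border-rank-to-rank
interpolation on Kronecker powers (Bläser 2013, Lemma 6.4), pending in the tree.
[cite: AlmanDuanVassilevskaWilliamsXuXuZhou2025, §3.6] -/
def advxxz2025_asymptoticRank_bigCwTensor_le : Prop :=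
  ∀ (K : Type) [Field K] (q : ℕ), asymptoticRank (bigCwTensor K q) ≤ q + 2

/-- The `≤` half of `BCS1997_algBorderRank_bigCwTensor` holds unconditionally (and for all `q`).
[cite: BurgisserClausenShokrollahi1997, §15.8] -/
theorem BCS1997_algBorderRank_bigCwTensor.le_half (K : Type) [Field K] (q : ℕ) :
    algBorderRank (bigCwTensor K q) ≤ q + 2 :=
  algBorderRank_bigCwTensor_le K q

end Facts

end Literature.Computability.AlgebraicComplexity

end
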